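import Literature.Computability.AlgebraicComplexity.ValiantConjectureEquivProofs
import Summits.ValiantsHypothesis.Statement

/-!
# Sanity (agreement) lemmas for `Literature.PNP.ValiantHypothesis` (pub-symmetroid REVIEW-RUNBOOK, card `ValiantHypothesis`)

Review evidence only (ops-runbook sanity registry `registry/pub-symmetroid.json`); no new definitions, no new
mathematics.  `Literature.PNP.ValiantHypothesis k := VP k ≠ VNP k` (Bürgisser's form,
`Summits/ValiantsHypothesis/ValiantsHypothesis/Statement.lean`) is an OPEN CONJECTURE at every field `k`, so no
holds- or fails-instance can be written; what CAN be pinned is that the Lean text is the statement the sources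
print, in each of their wordings:

* Bürgisser–Clausen–Shokrollahi 1997 (21.19) / Bürgisser 2024 Def. 2.25: `VP_k ≠ VNP_k` — the definition itself;
* von zur Gathen 1987 §4: "there exist p-definable families of polynomials that are not p-computable" —
  `valiantHypothesis_iff_exists_mem_VNP_not_mem_VP` (via `VP ⊆ VNP`, `VP_subset_VNP_holds`);
* equivalently `VNP_k ⊄ VP_k` — `valiantHypothesis_iff_not_VNP_subset_VP`;
* over `ℂ` (the summit statement `ValiantsHypothesis`, definitionally `ValiantHypothesis ℂ` —
  `valiantsHypothesis_iff_valiantHypothesis_complex`): "the permanent is not p-computable" (von zur Gathen 1987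
  Prop. 4.8 with Thm. 5.4; Bürgisser 2000 Rem. 2.11) — `valiantsHypothesis_iff_perPoly_not_isPComputable`, a
  restatement BY NAME of the tree's `perNotPComputableComplex_iff_holds` (which is stated in unfolded form).
-/

set_option linter.dupNamespace false

namespace Summit.ValiantsHypothesis.ValiantsHypothesis.Theorems

open Literature.PNP Literature.Computability.AlgebraicComplexity

universe u

variable (k : Type u) [Field k]

/-- Valiant's hypothesis over `k` says exactly that `VNP_k` is NOT contained in `VP_k` (the other inclusion
`VP_k ⊆ VNP_k` always holds, `VP_subset_VNP_holds`). -/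
theorem valiantHypothesis_iff_not_VNP_subset_VP : ValiantHypothesis k ↔ ¬ (VNP k ⊆ VP k) := by
  unfold ValiantHypothesis
  refine ⟨fun h hsub => h (Set.Subset.antisymm (VP_subset_VNP_holds k) hsub), fun h heq => h ?_⟩
  rw [← heq]

/-- Von zur Gathen's wording of Valiant's hypothesis (1987, §4): SOME p-definable family over `k` is not
p-computable over `k`. -/
theorem valiantHypothesis_iff_exists_mem_VNP_not_mem_VP :
    ValiantHypothesis k ↔ ∃ f, f ∈ VNP k ∧ f ∉ VP k := by
  rw [valiantHypothesis_iff_not_VNP_subset_VP, Set.not_subset]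

/-- The summit statement `ValiantsHypothesis` IS Valiant's hypothesis over `ℂ` (by definition). -/
theorem valiantsHypothesis_iff_valiantHypothesis_complex : ValiantsHypothesis ↔ ValiantHypothesis ℂ :=
  Iff.rfl

/-- Over `ℂ`, Valiant's hypothesis is equivalent to "the permanent family `(PER_n)_n` is not p-computable"
(pnp.S04; von zur Gathen 1987, Prop. 4.8 with Thm. 5.4; Bürgisser 2000, Rem. 2.11) — the tree's
`perNotPComputableComplex_iff_holds`, restated with the conjecture's NAME on one side. -/
theorem valiantsHypothesis_iff_perPoly_not_isPComputable :
    ValiantHypothesis ℂ ↔ ¬ IsPComputable (fun n => perPoly (Fin n) ℂ) :=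
  perNotPComputableComplex_iff_holds.symm

/-- Hence the textbook picture in one line: Valiant's hypothesis over `ℂ` holds iff the permanent family is a
p-definable family outside `VP_ℂ` … in particular iff SOME `VNP_ℂ` family lies outside `VP_ℂ`. -/
theorem valiantsHypothesis_iff_exists_complex : ValiantsHypothesis ↔ ∃ f, f ∈ VNP ℂ ∧ f ∉ VP ℂ :=
  valiantHypothesis_iff_exists_mem_VNP_not_mem_VP ℂ

end Summit.ValiantsHypothesis.ValiantsHypothesis.Theorems
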